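import Summits.QuantumFields.YangMills.Theorems.ForcedResponseSkewnessRunningCouplingCeilingCovAxisDomination
import HarnessLib

/-!
# Route `ForcedResponseSkewness`, crux `RunningCouplingCeiling` ⟨stmt-QuantumFields-24275⟩ — `AxisEndpointMax` (RP-soft stub of the
# alternative skeleton line «moebius-crossover-export», ym-idea-3 g26, critic PASS by hash 2026-08-30T00:10:59Z) PROVED in its letter:
# reflection-positivity LOG-CONVEXITY of both on-axis orders and the endpoint maximum principle

Helper file (`--supports stmt-QuantumFields-24275`; free-hands seat `ym-line-frs-p2` g20; sequel of `…CovAxisDomination`).  Definition-free,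
0 sorry, standard axioms.  No item is closed; no summit, no crux and no mass gap is proved by this file.

WHAT.  `lcc(n) = lCC(Q^θ,Q,n)`, `lcc'(n) = lCC(Q,Q^θ,n)` (`lCC = latticeConnectedCorr r.ρ β (2L+1)`, `Q = r.curvature.F`,
`Q^θ = r.curvature.timeReflect.F`; the skeleton-local `lcc`/`lcc'` of HOME `ym-idea-3/g26/line-moebius-crossover-export.lean` l.94/98, UNFOLDED).

* §1 `isCylinder_curvature_strict`, `dependsOn_dens_cfgReflect_posHalf_one`: with the STRICT cylinder set of the action density (plaquettes
  `i < j` only — the declared `supp` also carries the degenerate pairs) the temporal links are based at time `0`, so the reflected density at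
  height `t' ≥ 1` (not only `≥ 2`) is an observable of the closed non-negative half of the odd torus;
* §2 ★ `sq_lcc'_le` — the Gram pair of TWO reflected insertions at heights `t₁, t₂ ≥ 1` (`tᵢ + 1 ≤ L`):
  `lcc'(t₁+t₂)² ≤ lcc'(2t₁)·lcc'(2t₂)`, both `≥ 0` (✓`OddTorusCovCauchySchwarz` + ✓`lcc'_eq_mixedKernel_neg`); the order `lcc` is g19's
  ✓`sq_mixedKernel_le_lcc_mul_lcc`;
* §3 `endpointMax_of_logConvex` — a non-negative sequence, midpoint-log-convex at the interior points of `[s₀, s₁]`, is bounded there by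
  `max (c s₀) (c s₁)` (combinatorial lemma written and farm-checked by ym-idea-3 g26, HOME `g26/soft-stub-helpers.lean`; reproduced with credit);
* §4 ★ `axisEndpointMax` — the stub letter: for `β ≥ 0`, `1 ≤ s₀ ≤ s ≤ s₁`, `s₁ + 2 ≤ L`:
  `lcc(2s) ≤ max (lcc(2s₀)) (lcc(2s₁))` and `lcc'(2s) ≤ max (lcc'(2s₀)) (lcc'(2s₁))`.

[cite: OsterwalderSeiler1978, §2]; [cite: FrohlichIsraelLiebSimon1978, Thm. 2.1].  HONEST LABEL: soft lattice lemmas (reflection positivity);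
`MoebiusRow` (XL) / `CrossoverDecay` (L–XL), ⟨24275⟩, ⟨23763⟩, ⟨26871⟩ OPEN; the Yang–Mills mass gap is NOT proved; no summit is proved by a line.
-/

set_option autoImplicit false

noncomputable section

open MeasureTheory Filter Topology
open Literature.MathematicalPhysics.QuantumFieldTheory Literature.MathematicalPhysics.QuantumLattice
open Literature.Probability.LatticeModels (Site)
open Summit.QuantumFields.YangMills.Cruxes.OSLegsFromFemtoAndGap.DlrCollarTransfer
open Summit.QuantumFields.YangMills.Cruxes.OSLegsFromFemtoAndGap.DlrCollarTransfer.StubLower (exists_abs_dens_le)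
open Summit.QuantumFields.YangMills.Cruxes.NT.MarkovMirror (dependsOn_strictHalf_of_posHalf dependsOn_posHalf_of_window
  continuous_cfgReflect isCylinder_comp_cfgReflect)
open Summit.QuantumFields.YangMills.Cruxes.NT.ConjugateResponse (torusE_comp_cfgReflect)
open Summit.QuantumFields.YangMills.Theorems.CurvatureKernel (OddTorusCovCauchySchwarz)
open Summit.QuantumFields.YangMills.Theorems.F4SubCurvatureDoorSubCurvatureClauseMixedAxisDomination
  (lcc_eq_mixedKernel mixedCov_translate sq_mixedKernel_le_lcc_mul_lcc)
open Summit.QuantumFields.YangMills.Theorems.ForcedResponseSkewnessRunningCouplingCeilingCovAxisDomination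
  (reflectEdge_fst_zero dens_cfgReflect_eq lcc'_eq_mixedKernel_neg)

namespace Summit.QuantumFields.YangMills.Theorems.ForcedResponseSkewnessRunningCouplingCeilingAxisEndpointMax

variable {G : Type} [Group G] [TopologicalSpace G] [IsTopologicalGroup G] [CompactSpace G]
  [MeasurableSpace G] [BorelSpace G]

/-! ## §1 The strict cylinder set of the action density; reflected insertions at height `≥ 1` -/

/-- **The action density is a cylinder observable of the plaquettes `i < j` based at the origin** (the declared support of
`r.curvature` is the union over ALL pairs, including the degenerate ones). [folklore] -/
theorem isCylinder_curvature_strict (r : LatticeRep G) :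
    IsCylinder r.curvature.F
      ((Finset.univ.filter fun p : Fin 4 × Fin 4 => p.1 < p.2).biUnion fun p => originPlaquetteSupport p.1 p.2) := by
  intro U V h
  show actionDensity r.ρ U = actionDensity r.ρ V
  unfold actionDensity
  refine Finset.sum_congr rfl fun i _ => Finset.sum_congr rfl fun j _ => ?_
  by_cases hij : i < j
  · simp only [hij, ↓reduceIte]
    exact isCylinder_plaquetteObs_zero r.ρ i j fun e he =>
      h e (Finset.mem_coe.2 (Finset.mem_biUnion.2
        ⟨(i, j), Finset.mem_filter.2 ⟨Finset.mem_univ _, hij⟩, Finset.mem_coe.1 he⟩))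
  · simp only [hij, ↓reduceIte]

/-- Time structure of the strict cylinder set: base times lie in `{0, 1}` and TEMPORAL links are based at time `0`. [folklore] -/
theorem strict_supp_time {e : Literature.MathematicalPhysics.QuantumLattice.ZdEdge 4}
    (he : e ∈ (Finset.univ.filter fun p : Fin 4 × Fin 4 => p.1 < p.2).biUnion fun p => originPlaquetteSupport p.1 p.2) :
    (e.1 0 = 0 ∨ e.1 0 = 1) ∧ (e.2 = 0 → e.1 0 = 0) := by
  rw [Finset.mem_biUnion] at he
  obtain ⟨p, hp, hep⟩ := he
  have hij : p.1 < p.2 := (Finset.mem_filter.1 hp).2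
  have hj0 : p.2 ≠ 0 := fun h => by rw [h] at hij; exact (Nat.not_lt_zero _) hij
  simp only [originPlaquetteSupport, Finset.mem_insert, Finset.mem_singleton] at hep
  rcases hep with rfl | rfl | rfl | rfl
  · exact ⟨Or.inl rfl, fun _ => rfl⟩
  · refine ⟨?_, fun h => absurd h hj0⟩
    by_cases h : p.1 = 0
    · exact Or.inr (by simp [h])
    · exact Or.inl (by simp [h])
  · refine ⟨?_, fun h => ?_⟩
    · by_cases h : p.2 = 0
      · exact Or.inr (by simp [h])
      · exact Or.inl (by simp [h])
    · simp only [] at h ⊢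
      simp [hj0]
  · exact ⟨Or.inl rfl, fun h => absurd h hj0⟩

/-- **A density insertion at a site of time `u₀ ≤ −1` with `−u₀ + 1 ≤ L`, read on the reflected lifted field, is an observable of the
closed non-negative half** of the odd torus `2L+1` (sharpening ✓`dependsOn_dens_cfgReflect_posHalf`, which asks `u₀ ≤ −2`: with the strict
cylinder set the reflected temporal links sit at time `−u₀ − 1 ≥ 0`). [folklore] -/
theorem dependsOn_dens_cfgReflect_posHalf_one (r : LatticeRep G) (L : ℕ) (u : Site 4) (hu : u 0 ≤ -1 ∧ -(u 0) + 1 ≤ (L : ℤ)) :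
    DependsOn (fun U : GaugeConfig 4 (2 * L + 1) G => dens G r u (cfgReflect (torusLift (2 * L + 1) U)))
      {e : Edge 4 (2 * L + 1) | (e.1 0).val ≤ L ∧ ((e.1.shift e.2) 0).val ≤ L} := by
  have hcyl := IsCylinder.comp_configShift (isCylinder_comp_cfgReflect (isCylinder_curvature_strict r)) (-(siteReflect u))
  have hfun : (fun U : GaugeConfig 4 (2 * L + 1) G => dens G r u (cfgReflect (torusLift (2 * L + 1) U))) =
      fun U => ((fun V => r.curvature.F (cfgReflect V)) ∘ configShift (-(siteReflect u))) (torusLift (2 * L + 1) U) := by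
    funext U
    rw [dens_cfgReflect_eq r u]
    rfl
  rw [hfun]
  refine dependsOn_posHalf_of_window (G := G) L hcyl fun e he => ?_
  obtain ⟨e₁, he₁, rfl⟩ := Finset.mem_image.1 he
  obtain ⟨e₂, he₂, rfl⟩ := Finset.mem_image.1 he₁
  have key := reflectEdge_fst_zero e₂
  obtain ⟨ht, htemp⟩ := strict_supp_time he₂
  show 0 ≤ ((reflectEdge e₂).1 - -siteReflect u) 0 ∧ ((reflectEdge e₂).1 - -siteReflect u) 0 + 1 ≤ (L : ℤ)
  rw [Pi.sub_apply, Pi.neg_apply, siteReflect_apply_zero, key]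
  obtain ⟨hu1, hu2⟩ := hu
  by_cases h2 : e₂.2 = 0
  · rw [if_pos h2, htemp h2]
    constructor <;> omega
  · rw [if_neg h2]
    rcases ht with h0 | h1
    · rw [h0]; constructor <;> omega
    · rw [h1]; constructor <;> omega

/-! ## §2 ★ The Gram pair of two reflected insertions: log-convexity data for the mirror order -/

/-- ★ **Two reflected insertions.**  On the odd torus `2L+1` at `β ≥ 0`, for heights `1 ≤ t₁, t₂` with `tᵢ + 1 ≤ L`:
`lcc'(t₁+t₂)² ≤ lcc'(2t₁)·lcc'(2t₂)` with both factors `≥ 0`, where `lcc'(n) = lCC(Q,Q^θ,n)`.  Gram pair for ✓`OddTorusCovCauchySchwarz`: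
`F = dens(−t₁e₀) ∘ Θ₀ ∘ lift`, `H = dens(−t₂e₀) ∘ Θ₀ ∘ lift`. [cite: OsterwalderSeiler1978, §2] [cite: FrohlichIsraelLiebSimon1978, Thm. 2.1] -/
theorem sq_lcc'_le (r : LatticeRep G) {β : ℝ} (hβ : 0 ≤ β) (L t₁ t₂ : ℕ) (h1 : 1 ≤ t₁) (h2 : 1 ≤ t₂)
    (h1L : t₁ + 1 ≤ L) (h2L : t₂ + 1 ≤ L) :
    0 ≤ latticeConnectedCorr r.ρ β (2 * L + 1) r.curvature.F r.curvature.timeReflect.F (2 * t₁) ∧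
    0 ≤ latticeConnectedCorr r.ρ β (2 * L + 1) r.curvature.F r.curvature.timeReflect.F (2 * t₂) ∧
    (latticeConnectedCorr r.ρ β (2 * L + 1) r.curvature.F r.curvature.timeReflect.F (t₁ + t₂)) ^ 2 ≤
      latticeConnectedCorr r.ρ β (2 * L + 1) r.curvature.F r.curvature.timeReflect.F (2 * t₁) *
        latticeConnectedCorr r.ρ β (2 * L + 1) r.curvature.F r.curvature.timeReflect.F (2 * t₂) := by
  haveI := r.secondCountableTopology
  have hL : 1 ≤ L := by omega
  set u₁ : Site 4 := -Pi.single 0 (t₁ : ℤ) with hu₁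
  set u₂ : Site 4 := -Pi.single 0 (t₂ : ℤ) with hu₂
  have hu₁0 : u₁ 0 = -(t₁ : ℤ) := by simp [hu₁]
  have hu₂0 : u₂ 0 = -(t₂ : ℤ) := by simp [hu₂]
  have hsub : ∀ z : Site 4, z - siteReflect z = Pi.single 0 (2 * z 0) := by
    intro z
    funext k
    rw [Pi.sub_apply, siteReflect_apply_ite]
    by_cases hk : k = 0
    · subst hk; simp; ring
    · simp [hk]
  have hθ₂ : siteReflect u₂ = -u₂ := by
    funext k
    rw [siteReflect_apply_ite]
    by_cases hk : k = 0
    · subst hk; simp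
    · simp [hk, hu₂]
  have h11 : u₁ - siteReflect u₁ = -(Pi.single 0 ((2 * t₁ : ℕ) : ℤ)) := by
    rw [hsub, hu₁0]
    funext k
    by_cases hk : k = 0
    · subst hk; simp
    · simp [hk]
  have h22 : u₂ - siteReflect u₂ = -(Pi.single 0 ((2 * t₂ : ℕ) : ℤ)) := by
    rw [hsub, hu₂0]
    funext k
    by_cases hk : k = 0
    · subst hk; simp
    · simp [hk]
  have h12 : u₁ - siteReflect u₂ = -(Pi.single 0 ((t₁ + t₂ : ℕ) : ℤ)) := by
    rw [hθ₂, sub_neg_eq_add, hu₁, hu₂]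
    funext k
    by_cases hk : k = 0
    · subst hk; simp; ring
    · simp [hk]
  obtain ⟨C, -, hC⟩ := exists_abs_dens_le G r
  set F : GaugeConfig 4 (2 * L + 1) G → ℝ := fun U => dens G r u₁ (cfgReflect (torusLift (2 * L + 1) U)) with hF
  set H : GaugeConfig 4 (2 * L + 1) G → ℝ := fun U => dens G r u₂ (cfgReflect (torusLift (2 * L + 1) U)) with hH
  have hFm : Measurable F :=
    ((continuous_dens r u₁).comp (continuous_cfgReflect.comp (continuous_torusLift _))).measurable
  have hHm : Measurable H :=
    ((continuous_dens r u₂).comp (continuous_cfgReflect.comp (continuous_torusLift _))).measurable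
  have hFb : ∃ K : ℝ, ∀ U, |F U| ≤ K := ⟨C, fun U => hC _ _⟩
  have hHb : ∃ K : ℝ, ∀ U, |H U| ≤ K := ⟨C, fun U => hC _ _⟩
  have hFd := dependsOn_strictHalf_of_posHalf hL
    (dependsOn_dens_cfgReflect_posHalf_one r L u₁ ⟨by rw [hu₁0]; omega, by rw [hu₁0]; omega⟩)
  have hHd := dependsOn_strictHalf_of_posHalf hL
    (dependsOn_dens_cfgReflect_posHalf_one r L u₂ ⟨by rw [hu₂0]; omega, by rw [hu₂0]; omega⟩)
  obtain ⟨k1, k2, k3⟩ := OddTorusCovCauchySchwarz G r.N r.ρ r.continuous β hβ L hL F H hFm hHm hFb hHb hFd hHd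
  simp only [hF, hH, torusLift_negReflect, cfgReflect_cfgReflect] at k1 k2 k3
  -- dictionary between the lifted integrals and the `torusE` letters
  have iP : ∀ u v : Site 4,
      (∫ U, dens G r u (torusLift (2 * L + 1) U) * dens G r v (cfgReflect (torusLift (2 * L + 1) U))
        ∂(wilsonMeasure (d := 4) (L := 2 * L + 1) r.ρ β)) =
      torusE G r β L (fun V => dens G r v (cfgReflect V) * dens G r u V) := by
    intro u v
    unfold torusE
    congr 1
    funext U
    ring
  have iM : ∀ u : Site 4,
      (∫ U, dens G r u (cfgReflect (torusLift (2 * L + 1) U)) ∂(wilsonMeasure (d := 4) (L := 2 * L + 1) r.ρ β)) =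
      torusE G r β L (dens G r u) := by
    intro u
    have h := torusE_comp_cfgReflect G r β L (dens G r u)
    unfold torusE at h
    exact h
  rw [iP, iM] at k1
  rw [iP, iM] at k2
  rw [iP, iM, iM, iP, iP] at k3
  have e11 : torusE G r β L (fun V => dens G r u₁ (cfgReflect V) * dens G r u₁ V) - torusE G r β L (dens G r u₁) * torusE G r β L (dens G r u₁) =
      latticeConnectedCorr r.ρ β (2 * L + 1) r.curvature.F r.curvature.timeReflect.F (2 * t₁) := by
    rw [mixedCov_translate r β L u₁ u₁, h11, ← lcc'_eq_mixedKernel_neg]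
  have e22 : torusE G r β L (fun V => dens G r u₂ (cfgReflect V) * dens G r u₂ V) - torusE G r β L (dens G r u₂) * torusE G r β L (dens G r u₂) =
      latticeConnectedCorr r.ρ β (2 * L + 1) r.curvature.F r.curvature.timeReflect.F (2 * t₂) := by
    rw [mixedCov_translate r β L u₂ u₂, h22, ← lcc'_eq_mixedKernel_neg]
  have e12 : torusE G r β L (fun V => dens G r u₂ (cfgReflect V) * dens G r u₁ V) - torusE G r β L (dens G r u₁) * torusE G r β L (dens G r u₂) =
      latticeConnectedCorr r.ρ β (2 * L + 1) r.curvature.F r.curvature.timeReflect.F (t₁ + t₂) := by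
    rw [mul_comm (torusE G r β L (dens G r u₁)), mixedCov_translate r β L u₂ u₁, h12, ← lcc'_eq_mixedKernel_neg]
  rw [e11] at k1 k3
  rw [e22] at k2 k3
  rw [e12] at k3
  exact ⟨k1, k2, k3⟩

/-! ## §3 The endpoint maximum principle for midpoint-log-convex non-negative sequences -/

/-- **Endpoint maximum from midpoint log-convexity** (combinatorial lemma of ym-idea-3 g26, HOME `g26/soft-stub-helpers.lean`, reproduced):
if `c ≥ 0` on `[s₀, s₁]` and `c(s)² ≤ c(s−1)·c(s+1)` at every interior `s`, then `c(s) ≤ max (c s₀) (c s₁)` on the window (the largest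
maximiser is an endpoint). [folklore] -/
theorem endpointMax_of_logConvex (c : ℕ → ℝ) (s₀ s₁ : ℕ) (hle : s₀ ≤ s₁)
    (hnn : ∀ s, s₀ ≤ s → s ≤ s₁ → 0 ≤ c s)
    (hlc : ∀ s, s₀ < s → s < s₁ → c s ^ 2 ≤ c (s - 1) * c (s + 1)) :
    ∀ s, s₀ ≤ s → s ≤ s₁ → c s ≤ max (c s₀) (c s₁) := by
  classical
  set S : Finset ℕ := Finset.Icc s₀ s₁ with hS
  have hSne : S.Nonempty := ⟨s₀, by simp [hS, hle]⟩
  set M : ℝ := S.sup' hSne c with hM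
  have hcM : ∀ s, s₀ ≤ s → s ≤ s₁ → c s ≤ M := fun s h1 h2 =>
    Finset.le_sup' c (show s ∈ S by simp [hS, h1, h2])
  set T : Finset ℕ := S.filter (fun s => c s = M) with hT
  have hTne : T.Nonempty := by
    obtain ⟨s, hs, hcs⟩ := Finset.exists_mem_eq_sup' hSne c
    exact ⟨s, by simp [hT, hs, hcs.symm, hM]⟩
  set m : ℕ := T.max' hTne with hm
  have hmT : m ∈ T := Finset.max'_mem T hTne
  have hmS : m ∈ S := (Finset.mem_filter.1 hmT).1
  have hcm : c m = M := (Finset.mem_filter.1 hmT).2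
  have hm0 : s₀ ≤ m := (Finset.mem_Icc.1 hmS).1
  have hm1 : m ≤ s₁ := (Finset.mem_Icc.1 hmS).2
  suffices hsuff : M ≤ max (c s₀) (c s₁) from fun s h1 h2 => (hcM s h1 h2).trans hsuff
  by_cases hMpos : M ≤ 0
  · exact hMpos.trans ((hnn s₀ le_rfl hle).trans (le_max_left _ _))
  have hMpos' : 0 < M := lt_of_not_ge hMpos
  rcases eq_or_lt_of_le hm1 with h | h
  · rw [← hcm, h]; exact le_max_right _ _
  rcases eq_or_lt_of_le hm0 with h0 | h0
  · rw [← hcm, ← h0]; exact le_max_left _ _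
  exfalso
  have hlcm := hlc m h0 h
  have hprev : c (m - 1) ≤ M := hcM (m - 1) (by omega) (by omega)
  have hnext0 : 0 ≤ c (m + 1) := hnn (m + 1) (by omega) (by omega)
  have hnextM : c (m + 1) ≤ M := hcM (m + 1) (by omega) (by omega)
  rw [hcm] at hlcm
  have h1 : M ^ 2 ≤ M * c (m + 1) := hlcm.trans (mul_le_mul_of_nonneg_right hprev hnext0)
  have h2 : M ≤ c (m + 1) := by
    rw [sq] at h1
    exact le_of_mul_le_mul_left h1 hMpos'
  have hnext : c (m + 1) = M := le_antisymm hnextM h2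
  have hmem : m + 1 ∈ T := by
    simp only [hT, Finset.mem_filter, hS, Finset.mem_Icc]
    exact ⟨⟨by omega, by omega⟩, hnext⟩
  have := Finset.le_max' T (m + 1) hmem
  rw [← hm] at this
  omega

/-! ## §4 ★ `AxisEndpointMax` in its letter -/

/-- ★ **`AxisEndpointMax`** (the RP-soft stub `stub_axisEndpointMax` of line «moebius-crossover-export» on ⟨stmt-QuantumFields-24275⟩, in its
letter with `lcc`/`lcc'` unfolded): on a window of heights `1 ≤ s₀ ≤ s ≤ s₁`, `s₁ + 2 ≤ L`, at `β ≥ 0`, the reflected on-axis correlator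
of either order is bounded by the larger of its two endpoint values. [cite: OsterwalderSeiler1978, §2] -/
theorem axisEndpointMax : ∀ (G : Type) [Group G] [TopologicalSpace G] [IsTopologicalGroup G] [CompactSpace G],
    IsCompactSimpleLieGroup G →
    letI : MeasurableSpace G := borel G
    haveI : BorelSpace G := ⟨rfl⟩
    ∀ (r : LatticeRep G) (β : ℝ), 0 ≤ β → ∀ (L s₀ s s₁ : ℕ), 1 ≤ s₀ → s₀ ≤ s → s ≤ s₁ → s₁ + 2 ≤ L →
      latticeConnectedCorr r.ρ β (2 * L + 1) r.curvature.timeReflect.F r.curvature.F (2 * s) ≤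
          max (latticeConnectedCorr r.ρ β (2 * L + 1) r.curvature.timeReflect.F r.curvature.F (2 * s₀))
            (latticeConnectedCorr r.ρ β (2 * L + 1) r.curvature.timeReflect.F r.curvature.F (2 * s₁)) ∧
        latticeConnectedCorr r.ρ β (2 * L + 1) r.curvature.F r.curvature.timeReflect.F (2 * s) ≤
          max (latticeConnectedCorr r.ρ β (2 * L + 1) r.curvature.F r.curvature.timeReflect.F (2 * s₀))
            (latticeConnectedCorr r.ρ β (2 * L + 1) r.curvature.F r.curvature.timeReflect.F (2 * s₁)) := by
  intro G _ _ _ _ _hG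
  letI : MeasurableSpace G := borel G
  haveI : BorelSpace G := ⟨rfl⟩
  intro r β hβ L s₀ s s₁ hs₀ h0s hs1 hs₁L
  constructor
  · -- order `(Q^θ, Q)`: g19's single-order axis domination on the axis itself
    refine endpointMax_of_logConvex
      (fun t => latticeConnectedCorr r.ρ β (2 * L + 1) r.curvature.timeReflect.F r.curvature.F (2 * t)) s₀ s₁ (h0s.trans hs1)
      (fun t _ ht1 => ?_) (fun t ht0 ht1 => ?_) s h0s hs1
    · exact (sq_mixedKernel_le_lcc_mul_lcc r hβ L t t (by omega) (by omega) (Pi.single 0 ((t : ℤ) + t)) (by simp)).2.1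
    · have h := (sq_mixedKernel_le_lcc_mul_lcc r hβ L (t + 1) (t - 1) (by omega) (by omega)
        (Pi.single 0 ((2 * t : ℕ) : ℤ)) (by simp; omega)).2.2
      rw [← lcc_eq_mixedKernel] at h
      exact h
  · -- mirror order `(Q, Q^θ)`: the Gram pair of two reflected insertions
    refine endpointMax_of_logConvex
      (fun t => latticeConnectedCorr r.ρ β (2 * L + 1) r.curvature.F r.curvature.timeReflect.F (2 * t)) s₀ s₁ (h0s.trans hs1)
      (fun t ht0 ht1 => ?_) (fun t ht0 ht1 => ?_) s h0s hs1
    · exact (sq_lcc'_le r hβ L t t (by omega) (by omega) (by omega) (by omega)).1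
    · have h := (sq_lcc'_le r hβ L (t - 1) (t + 1) (by omega) (by omega) (by omega) (by omega)).2.2
      rw [show t - 1 + (t + 1) = 2 * t by omega] at h
      exact h

end Summit.QuantumFields.YangMills.Theorems.ForcedResponseSkewnessRunningCouplingCeilingAxisEndpointMax

end
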